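import Summits.CriticalPhenomena.SAWScalingLimit.Theorems.SAWDefectDecoherenceBoundaryClosureRLocalL1SmoothToContinuous
import Summits.CriticalPhenomena.SAWScalingLimit.Theorems.MassRatio.Negative.Tools
import Literature.Analysis.Complex.WeylLemmaDbar
import Literature.Probability.RandomPlanarGeometry.HexParafermion
import HarnessLib

/-!
# The developing map against test functions: three analysis steps
(crux `BoundaryClosureR`, stmt-CriticalPhenomena-14004, line `pick-half-plane`,
stub `stub_developingMapLimitHolomorphic`)

* `differentiableOn_of_integral_dbar` — a CONTINUOUS function on an open set whose
  distributional `∂̄` vanishes is holomorphic there (Weyl's lemma `weyl_dbar` gives a holomorphic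
  a.e.-representative; two continuous functions agreeing a.e. on an open set agree).
* `integral_mul_wirtinger_d` — integration by parts for holomorphic `h` on an open `U` against
  `φ ∈ C¹_c(U)`: `∫ h ∂φ = −∫ φ h'` (Mathlib's line-derivative integration by parts in the two
  coordinate directions).
* `tendsto_functional_of_smooth` — the normalised bulk functionals
  `N_δ(ψ) = δ² Σ_{z ∈ Ω_δ} ψ(δ·mid z) F_δ(z)/F_δ(b δ)` converge on every CONTINUOUS compactly
  supported `ψ` in `U` to `∫ ψ g` (`g` continuous on `U`) as soon as they do on smooth ones,
  given the local `L¹` law (`3ε`-argument: `|N_δ(χ)| ≤ C_K sup|χ|`, `norm_functional_le`).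
References: H. Weyl (1940); Hörmander, *ALPDO I* Thm. 4.4.1; folklore.
-/

noncomputable section

open scoped Topology ContDiff
open Filter Set Metric Complex MeasureTheory
open Literature.Probability.LatticeModels Literature.Probability.RandomPlanarGeometry
open Literature.Probability.RandomPlanarGeometry.SAW
open Literature.Analysis.Complex (dbarAlong dbarAlong_one weyl_dbar)
open Summit.CriticalPhenomena.SAWScalingLimit.Theorems.MassRatio.Negative (hexDomainMidEdges_finite)
open Summit.CriticalPhenomena.SAWScalingLimit.Theorems.PickHalfPlane.LocalL1
  (continuous_mul_of_tsupport_subset exists_smooth_near)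

namespace Summit.CriticalPhenomena.SAWScalingLimit.Theorems.PickHalfPlane.DevelopingMap

/-! ### Holomorphy from the weak `∂̄`-equation -/

/-- **A continuous weakly `∂̄`-closed function is holomorphic.** If `h` is continuous on the open
set `U` and `∫ h ∂̄φ = 0` for all smooth `φ` compactly supported in `U`, then `h` is holomorphic
on `U` (Weyl's lemma; the holomorphic a.e.-representative agrees with `h` everywhere on `U` by
continuity). [folklore] -/
theorem differentiableOn_of_integral_dbar {U : Set ℂ} (hU : IsOpen U) {h : ℂ → ℂ}
    (hh : ContinuousOn h U)
    (hdbar : ∀ φ : ℂ → ℂ, ContDiff ℝ ∞ φ → HasCompactSupport φ → tsupport φ ⊆ U →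
      ∫ z, h z * dbarAlong 1 φ z = 0) :
    DifferentiableOn ℂ h U := by
  obtain ⟨g, hg, hae⟩ := weyl_dbar hU (hh.locallyIntegrableOn hU.measurableSet) hdbar
  have heq : EqOn h g U := by
    refine Measure.eqOn_open_of_ae_eq (μ := volume) ?_ hU hh hg.continuousOn
    rw [EventuallyEq, ae_restrict_iff' hU.measurableSet]
    filter_upwards [hae] with z hz hzU using hz hzU
  intro z hz
  have hev : h =ᶠ[𝓝 z] g := by
    filter_upwards [hU.mem_nhds hz] with w hw using heq hw
  exact ((hg.differentiableAt (hU.mem_nhds hz)).congr_of_eventuallyEq hev).differentiableWithinAt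

/-! ### Integration by parts against a holomorphic function -/

/-- **Integration by parts in one real direction** against a holomorphic function: for `h`
holomorphic on the open `U`, `φ ∈ C¹` with compact support in `U` and a direction `v`,
`∫ h · Dφ(·)v = −∫ (v h') φ`. [folklore] -/
theorem integral_mul_fderiv_apply {U : Set ℂ} (hU : IsOpen U) {h : ℂ → ℂ}
    (hh : DifferentiableOn ℂ h U) {φ : ℂ → ℂ} (hφ : ContDiff ℝ 1 φ) (hφc : HasCompactSupport φ)
    (hφU : tsupport φ ⊆ U) (v : ℂ) :
    ∫ z, h z * fderiv ℝ φ z v = -∫ z, v * deriv h z * φ z := by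
  have hhc : ContinuousOn h U := hh.continuousOn
  have hdc : ContinuousOn (deriv h) U := ((hh.analyticOnNhd hU).deriv).continuousOn
  have hφd : Differentiable ℝ φ := hφ.differentiable (by simp)
  have hDc : Continuous fun z => fderiv ℝ φ z v := (hφ.continuous_fderiv (by simp)).clm_apply continuous_const
  have hDs : tsupport (fun z => fderiv ℝ φ z v) ⊆ U := by
    refine (closure_minimal (fun z hz => ?_) (isClosed_tsupport φ)).trans hφU
    by_contra h'
    have h0 : fderiv ℝ φ z = 0 := by
      by_contra hne; exact h' (support_fderiv_subset ℝ (Function.mem_support.2 hne))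
    exact hz (by simp [h0])
  have hDcs : HasCompactSupport fun z => fderiv ℝ φ z v := hφc.fderiv_apply ℝ v
  -- the three integrands are continuous with compact support
  have c1 : Continuous fun z => h z * fderiv ℝ φ z v := by
    simpa only [mul_comm] using continuous_mul_of_tsupport_subset hU subset_rfl hDc hDs hhc
  have c2 : Continuous fun z => v * deriv h z * φ z := by
    have := continuous_mul_of_tsupport_subset hU subset_rfl hφ.continuous hφU hdc
    simpa only [mul_comm, mul_assoc, mul_left_comm] using this.const_mul v
  have c3 : Continuous fun z => h z * φ z := by
    simpa only [mul_comm] using continuous_mul_of_tsupport_subset hU subset_rfl hφ.continuous hφU hhc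
  have i1 : Integrable fun z => h z * fderiv ℝ φ z v := c1.integrable_of_hasCompactSupport hDcs.mul_left
  have i2 : Integrable fun z => v * deriv h z * φ z := c2.integrable_of_hasCompactSupport hφc.mul_left
  have i3 : Integrable fun z => h z * φ z := c3.integrable_of_hasCompactSupport hφc.mul_left
  -- line derivatives
  have hf : ∀ z ∈ tsupport φ, HasLineDerivAt ℝ h (v * deriv h z) z v := by
    intro z hz
    have hd : HasDerivAt h (deriv h z) z :=
      (hh.differentiableAt (hU.mem_nhds (hφU hz))).hasDerivAt
    have := (hd.hasFDerivAt.restrictScalars ℝ).hasLineDerivAt v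
    simpa [mul_comm] using this
  have hg : ∀ z ∈ tsupport h, HasLineDerivAt ℝ φ (fderiv ℝ φ z v) z v :=
    fun z _ => (hφd z).hasFDerivAt.hasLineDerivAt v
  have key := integral_bilinear_hasLineDerivAt_right_eq_neg_left_of_integrable
    (B := ContinuousLinearMap.mul ℝ ℂ) (μ := volume) (by simpa using i2) (by simpa using i1)
    (by simpa using i3) hf hg
  simpa using key

/-- **Integration by parts for `∂`**: for `h` holomorphic on the open `U` and `φ ∈ C¹_c(U)`,
`∫ h ∂φ = −∫ φ h'` with `∂φ = ½(φₓ − iφ_y)`. [folklore] -/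
theorem integral_mul_wirtinger_d {U : Set ℂ} (hU : IsOpen U) {h : ℂ → ℂ}
    (hh : DifferentiableOn ℂ h U) {φ : ℂ → ℂ} (hφ : ContDiff ℝ 1 φ) (hφc : HasCompactSupport φ)
    (hφU : tsupport φ ⊆ U) :
    ∫ z, h z * ((2 : ℂ)⁻¹ * (fderiv ℝ φ z 1 - I * fderiv ℝ φ z I)) = -∫ z, φ z * deriv h z := by
  have h1 := integral_mul_fderiv_apply hU hh hφ hφc hφU 1
  have hI := integral_mul_fderiv_apply hU hh hφ hφc hφU I
  -- integrability of the two pieces (continuous with compact support, as above)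
  have hhc : ContinuousOn h U := hh.continuousOn
  have hDc : ∀ v : ℂ, Continuous fun z => fderiv ℝ φ z v := fun v =>
    (hφ.continuous_fderiv (by simp)).clm_apply continuous_const
  have hDs : ∀ v : ℂ, tsupport (fun z => fderiv ℝ φ z v) ⊆ U := fun v => by
    refine (closure_minimal (fun z hz => ?_) (isClosed_tsupport φ)).trans hφU
    by_contra h'
    have h0 : fderiv ℝ φ z = 0 := by
      by_contra hne; exact h' (support_fderiv_subset ℝ (Function.mem_support.2 hne))
    exact hz (by simp [h0])
  have hint : ∀ v : ℂ, Integrable fun z => h z * fderiv ℝ φ z v := fun v => by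
    have c : Continuous fun z => h z * fderiv ℝ φ z v := by
      simpa only [mul_comm] using continuous_mul_of_tsupport_subset hU subset_rfl (hDc v) (hDs v) hhc
    exact c.integrable_of_hasCompactSupport (hφc.fderiv_apply ℝ v).mul_left
  have hsplit : ∫ z, h z * ((2 : ℂ)⁻¹ * (fderiv ℝ φ z 1 - I * fderiv ℝ φ z I)) =
      (2 : ℂ)⁻¹ * ((∫ z, h z * fderiv ℝ φ z 1) - I * ∫ z, h z * fderiv ℝ φ z I) := by
    rw [← integral_const_mul, ← integral_sub (hint 1) ((hint I).const_mul I), ← integral_const_mul]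
    exact integral_congr_ae (Eventually.of_forall fun z => by ring)
  rw [hsplit, h1, hI]
  have e2 : ∫ z, I * deriv h z * φ z = I * ∫ z, φ z * deriv h z := by
    rw [← integral_const_mul]
    exact integral_congr_ae (Eventually.of_forall fun z => by ring)
  have e1 : ∫ z, 1 * deriv h z * φ z = ∫ z, φ z * deriv h z :=
    integral_congr_ae (Eventually.of_forall fun z => by ring)
  rw [e1, e2]
  ring_nf
  rw [Complex.I_sq]
  ring

/-! ### From smooth to continuous test functions -/

/-- **Sup-norm bound for the normalised functional.** If `χ` vanishes off `K'` and
`‖χ‖ ≤ M` pointwise, then `‖δ² (Σ_{z∈Ω} χ(δ·mid z) F z)/F_b‖ ≤ M · δ² (Σ_{z∈Ω, δ·mid z ∈ K'} ‖F z‖)/‖F_b‖`.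
[folklore] -/
theorem norm_functional_le (S : Finset HexVertex) (F : Sym2 HexVertex → ℂ) (Fb : ℂ) (δ : ℝ)
    {χ : ℂ → ℂ} {K' : Set ℂ} {M : ℝ} (hM : ∀ z, ‖χ z‖ ≤ M) (hχK : ∀ z, z ∉ K' → χ z = 0) :
    ‖(δ : ℂ) ^ 2 * (∑ᶠ z ∈ hexDomainMidEdges S, χ ((δ : ℂ) * hexMidpoint z) * F z) / Fb‖ ≤
      M * (δ ^ 2 * (∑ᶠ z ∈ {z : Sym2 HexVertex | z ∈ hexDomainMidEdges S ∧
        (δ : ℂ) * hexMidpoint z ∈ K'}, ‖F z‖) / ‖Fb‖) := by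
  have hM0 : 0 ≤ M := (norm_nonneg _).trans (hM 0)
  set E : Set (Sym2 HexVertex) := {z | z ∈ hexDomainMidEdges S ∧ (δ : ℂ) * hexMidpoint z ∈ K'} with hE
  have hEfin : E.Finite := (hexDomainMidEdges_finite S).subset fun z hz => hz.1
  have hrestrict : (∑ᶠ z ∈ hexDomainMidEdges S, χ ((δ : ℂ) * hexMidpoint z) * F z) =
      ∑ᶠ z ∈ E, χ ((δ : ℂ) * hexMidpoint z) * F z := by
    refine finsum_mem_inter_support_eq _ _ _ ?_
    ext z
    simp only [Set.mem_inter_iff, Function.mem_support, hE, Set.mem_setOf_eq]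
    constructor
    · rintro ⟨hz, hne⟩
      refine ⟨⟨hz, ?_⟩, hne⟩
      by_contra h'
      exact hne (by rw [hχK _ h', zero_mul])
    · rintro ⟨⟨hz, -⟩, hne⟩; exact ⟨hz, hne⟩
  have hsum : ‖∑ᶠ z ∈ E, χ ((δ : ℂ) * hexMidpoint z) * F z‖ ≤ M * ∑ᶠ z ∈ E, ‖F z‖ := by
    rw [finsum_mem_eq_finite_toFinset_sum _ hEfin, finsum_mem_eq_finite_toFinset_sum _ hEfin,
      Finset.mul_sum]
    refine (norm_sum_le _ _).trans (Finset.sum_le_sum fun z _ => ?_)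
    rw [norm_mul]
    exact mul_le_mul_of_nonneg_right (hM _) (norm_nonneg _)
  rw [hrestrict, norm_div, norm_mul, norm_pow, Complex.norm_real, Real.norm_eq_abs, sq_abs]
  calc δ ^ 2 * ‖∑ᶠ z ∈ E, χ ((δ : ℂ) * hexMidpoint z) * F z‖ / ‖Fb‖
      ≤ δ ^ 2 * (M * ∑ᶠ z ∈ E, ‖F z‖) / ‖Fb‖ := by gcongr
    _ = M * (δ ^ 2 * (∑ᶠ z ∈ E, ‖F z‖) / ‖Fb‖) := by ring

/-- **From smooth to continuous test functions (weak convergence).**  Let the local `L¹` law hold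
on compacts of an open `U` for a family `(Λ δ, e δ, b δ)`, let `g` be continuous on `U`, and let
the normalised functionals converge along `ns` to `∫ φ g` for every SMOOTH compactly supported
`φ` in `U`.  Then they converge to `∫ ψ g` for every CONTINUOUS compactly supported `ψ` in `U`.
[folklore] -/
theorem tendsto_functional_of_smooth (Λ : ℝ → Finset HexVertex) (e b : ℝ → Sym2 HexVertex)
    {U : Set ℂ} (hU : IsOpen U)
    (hL1 : ∀ K : Set ℂ, IsCompact K → K ⊆ U → ∃ C : ℝ, ∀ᶠ δ : ℝ in 𝓝[>] 0,
      δ ^ 2 * (∑ᶠ z ∈ {z : Sym2 HexVertex | z ∈ hexDomainMidEdges (Λ δ) ∧ (δ : ℂ) * hexMidpoint z ∈ K},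
        ‖hexParafermionicObservable (Λ δ) (e δ) hexCriticalFugacity (5 / 8) z‖) ≤
      C * ‖hexParafermionicObservable (Λ δ) (e δ) hexCriticalFugacity (5 / 8) (b δ)‖)
    {ns : ℕ → ℝ} (hns : Tendsto ns atTop (𝓝[>] 0)) {g : ℂ → ℂ} (hg : ContinuousOn g U)
    (hsmooth : ∀ φ : ℂ → ℂ, ContDiff ℝ ∞ φ → HasCompactSupport φ → tsupport φ ⊆ U →
      Tendsto (fun n => ((ns n : ℝ) : ℂ) ^ 2 * (∑ᶠ z ∈ hexDomainMidEdges (Λ (ns n)),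
          φ (((ns n : ℝ) : ℂ) * hexMidpoint z) *
            hexParafermionicObservable (Λ (ns n)) (e (ns n)) hexCriticalFugacity (5 / 8) z) /
        hexParafermionicObservable (Λ (ns n)) (e (ns n)) hexCriticalFugacity (5 / 8) (b (ns n)))
        atTop (𝓝 (∫ z, φ z * g z)))
    {ψ : ℂ → ℂ} (hψ : Continuous ψ) (hψc : HasCompactSupport ψ) (hψU : tsupport ψ ⊆ U) :
    Tendsto (fun n => ((ns n : ℝ) : ℂ) ^ 2 * (∑ᶠ z ∈ hexDomainMidEdges (Λ (ns n)),
        ψ (((ns n : ℝ) : ℂ) * hexMidpoint z) *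
          hexParafermionicObservable (Λ (ns n)) (e (ns n)) hexCriticalFugacity (5 / 8) z) /
      hexParafermionicObservable (Λ (ns n)) (e (ns n)) hexCriticalFugacity (5 / 8) (b (ns n)))
      atTop (𝓝 (∫ z, ψ z * g z)) := by
  ---------------------------------------------------------------- room and constants
  set K : Set ℂ := tsupport ψ with hKdef
  have hK : IsCompact K := hψc
  obtain ⟨ε₁, hε₁, hε₁U⟩ := hK.exists_cthickening_subset_open hU hψU
  set V : Set ℂ := thickening ε₁ K with hV
  set K' : Set ℂ := cthickening ε₁ K with hK'
  have hVo : IsOpen V := isOpen_thickening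
  have hK'c : IsCompact K' := hK.cthickening
  have hKV : K ⊆ V := self_subset_thickening hε₁ K
  have hVK' : V ⊆ K' := thickening_subset_cthickening ε₁ K
  have hK'U : K' ⊆ U := hε₁U
  obtain ⟨C, hC⟩ := hL1 K' hK'c hK'U
  set C' : ℝ := max C 0 with hC'
  have hgK : IntegrableOn g K' := (hg.mono hK'U).integrableOn_compact hK'c
  set Ig : ℝ := ∫ z in K', ‖g z‖ with hIg
  have hIg0 : 0 ≤ Ig := integral_nonneg fun z => norm_nonneg _
  ---------------------------------------------------------------- the `3ε`-argument
  rw [Metric.tendsto_nhds]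
  intro ε hε
  set η : ℝ := ε / (2 * (C' + Ig + 1)) with hηdef
  have hη : 0 < η := by positivity
  obtain ⟨φ, hφ, hφc, hφV, hφψ⟩ := exists_smooth_near hVo hψ hψc (hKV) hη
  have hφU : tsupport φ ⊆ U := hφV.trans (hVK'.trans hK'U)
  have hφK' : tsupport φ ⊆ K' := hφV.trans hVK'
  -- the functional on the difference `ψ - φ`
  have hdiffK : ∀ z, z ∉ K' → ψ z - φ z = 0 := fun z hz => by
    rw [image_eq_zero_of_notMem_tsupport fun h => hz (hVK' (hKV h)),
      image_eq_zero_of_notMem_tsupport fun h => hz (hφK' h), sub_zero]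
  have hdiffM : ∀ z, ‖ψ z - φ z‖ ≤ η := fun z => by rw [norm_sub_rev]; exact hφψ z
  -- the integral on the difference
  have hcψ : Continuous fun z => ψ z * g z :=
    continuous_mul_of_tsupport_subset hU subset_rfl hψ hψU hg
  have hcφ : Continuous fun z => φ z * g z :=
    continuous_mul_of_tsupport_subset hU subset_rfl hφ.continuous hφU hg
  have hiψ : Integrable fun z => ψ z * g z := hcψ.integrable_of_hasCompactSupport hψc.mul_right
  have hiφ : Integrable fun z => φ z * g z := hcφ.integrable_of_hasCompactSupport hφc.mul_right
  have hIbound : ‖(∫ z, φ z * g z) - ∫ z, ψ z * g z‖ ≤ Ig * η := by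
    rw [← integral_sub hiφ hiψ]
    have hpt : ∀ z, ‖φ z * g z - ψ z * g z‖ ≤ K'.indicator (fun z => η * ‖g z‖) z := by
      intro z
      by_cases hz : z ∈ K'
      · rw [indicator_of_mem hz, ← sub_mul, norm_mul]
        exact mul_le_mul_of_nonneg_right (hφψ z) (norm_nonneg _)
      · rw [indicator_of_notMem hz, ← sub_mul, show φ z - ψ z = -(ψ z - φ z) by ring, hdiffK z hz]
        simp
    calc ‖∫ z, (φ z * g z - ψ z * g z)‖ ≤ ∫ z, ‖φ z * g z - ψ z * g z‖ :=
          norm_integral_le_integral_norm _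
      _ ≤ ∫ z, K'.indicator (fun z => η * ‖g z‖) z := by
          have hint : IntegrableOn (fun z => η * ‖g z‖) K' := hgK.norm.const_mul η
          exact integral_mono_of_nonneg (Eventually.of_forall fun z => norm_nonneg _)
            (hint.integrable_indicator hK'c.measurableSet) (Eventually.of_forall hpt)
      _ = Ig * η := by
          rw [integral_indicator hK'c.measurableSet, integral_const_mul, hIg, mul_comm]
  -- eventually: the `L¹` event and the smooth convergence within `η`
  have hev1 := hns.eventually hC
  have hev2 : ∀ᶠ n in atTop, dist (((ns n : ℝ) : ℂ) ^ 2 * (∑ᶠ z ∈ hexDomainMidEdges (Λ (ns n)),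
      φ (((ns n : ℝ) : ℂ) * hexMidpoint z) *
        hexParafermionicObservable (Λ (ns n)) (e (ns n)) hexCriticalFugacity (5 / 8) z) /
      hexParafermionicObservable (Λ (ns n)) (e (ns n)) hexCriticalFugacity (5 / 8) (b (ns n)))
      (∫ z, φ z * g z) < η := Metric.tendsto_nhds.1 (hsmooth φ hφ hφc hφU) η hη
  filter_upwards [hev1, hev2] with n hL1n hφn
  set δ : ℝ := ns n with hδ
  set S := Λ δ with hS
  set F : Sym2 HexVertex → ℂ := hexParafermionicObservable (Λ δ) (e δ) hexCriticalFugacity (5 / 8) with hF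
  -- linearity of the functional
  have hfin := hexDomainMidEdges_finite S
  have hlin : (δ : ℂ) ^ 2 * (∑ᶠ z ∈ hexDomainMidEdges S, ψ ((δ : ℂ) * hexMidpoint z) * F z) / F (b δ) -
      (δ : ℂ) ^ 2 * (∑ᶠ z ∈ hexDomainMidEdges S, φ ((δ : ℂ) * hexMidpoint z) * F z) / F (b δ) =
      (δ : ℂ) ^ 2 * (∑ᶠ z ∈ hexDomainMidEdges S,
        (ψ ((δ : ℂ) * hexMidpoint z) - φ ((δ : ℂ) * hexMidpoint z)) * F z) / F (b δ) := by
    simp only [sub_mul]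
    rw [finsum_mem_sub_distrib _ _ hfin]
    ring
  -- the bound on the difference functional
  have hNdiff : ‖(δ : ℂ) ^ 2 * (∑ᶠ z ∈ hexDomainMidEdges S,
      (ψ ((δ : ℂ) * hexMidpoint z) - φ ((δ : ℂ) * hexMidpoint z)) * F z) / F (b δ)‖ ≤ η * C' := by
    have h1 := norm_functional_le S F (F (b δ)) δ (χ := fun z => ψ z - φ z) hdiffM hdiffK
    refine h1.trans (mul_le_mul_of_nonneg_left ?_ hη.le)
    by_cases hFb : ‖F (b δ)‖ = 0
    · rw [hFb, div_zero]; exact le_max_right _ _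
    · rw [div_le_iff₀ (lt_of_le_of_ne (norm_nonneg _) (Ne.symm hFb))]
      exact hL1n.trans (mul_le_mul_of_nonneg_right (le_max_left _ _) (norm_nonneg _))
  -- combine
  have hC'0 : 0 ≤ C' := le_max_right _ _
  rw [dist_eq_norm] at hφn ⊢
  calc ‖(δ : ℂ) ^ 2 * (∑ᶠ z ∈ hexDomainMidEdges S, ψ ((δ : ℂ) * hexMidpoint z) * F z) / F (b δ) -
        ∫ z, ψ z * g z‖
      = ‖((δ : ℂ) ^ 2 * (∑ᶠ z ∈ hexDomainMidEdges S, ψ ((δ : ℂ) * hexMidpoint z) * F z) / F (b δ) -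
          (δ : ℂ) ^ 2 * (∑ᶠ z ∈ hexDomainMidEdges S, φ ((δ : ℂ) * hexMidpoint z) * F z) / F (b δ)) +
          (((δ : ℂ) ^ 2 * (∑ᶠ z ∈ hexDomainMidEdges S, φ ((δ : ℂ) * hexMidpoint z) * F z) / F (b δ) -
            ∫ z, φ z * g z)) + ((∫ z, φ z * g z) - ∫ z, ψ z * g z)‖ := by ring_nf
    _ ≤ ‖(δ : ℂ) ^ 2 * (∑ᶠ z ∈ hexDomainMidEdges S, ψ ((δ : ℂ) * hexMidpoint z) * F z) / F (b δ) -
          (δ : ℂ) ^ 2 * (∑ᶠ z ∈ hexDomainMidEdges S, φ ((δ : ℂ) * hexMidpoint z) * F z) / F (b δ)‖ +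
          ‖((δ : ℂ) ^ 2 * (∑ᶠ z ∈ hexDomainMidEdges S, φ ((δ : ℂ) * hexMidpoint z) * F z) / F (b δ) -
            ∫ z, φ z * g z)‖ + ‖(∫ z, φ z * g z) - ∫ z, ψ z * g z‖ :=
        (norm_add_le _ _).trans (add_le_add (norm_add_le _ _) le_rfl)
    _ ≤ η * C' + η + Ig * η := by
        rw [hlin]
        exact add_le_add (add_le_add hNdiff hφn.le) hIbound
    _ = η * (C' + Ig + 1) := by ring
    _ < ε := by
        rw [hηdef, div_mul_eq_mul_div, div_lt_iff₀ (by positivity)]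
        nlinarith


/-- **Registered helper `developingMapLimitHolomorphic_weakLimit`** (crux stmt-CriticalPhenomena-14004, line
`pick-half-plane`, stub `stub_developingMapLimitHolomorphic`): registry form (one `∀`-term) of
`tendsto_functional_of_smooth`. [folklore] -/
theorem developingMapLimitHolomorphic_weakLimit : ∀ (Λ : ℝ → Finset HexVertex) (e b : ℝ → Sym2 HexVertex) {U : Set ℂ} (hU : IsOpen U) (hL1 : ∀ K : Set ℂ, IsCompact K → K ⊆ U → ∃ C : ℝ, ∀ᶠ δ : ℝ in 𝓝[>] 0, δ ^ 2 * (∑ᶠ z ∈ {z : Sym2 HexVertex | z ∈ hexDomainMidEdges (Λ δ) ∧ (δ : ℂ) * hexMidpoint z ∈ K}, ‖hexParafermionicObservable (Λ δ) (e δ) hexCriticalFugacity (5 / 8) z‖) ≤ C * ‖hexParafermionicObservable (Λ δ) (e δ) hexCriticalFugacity (5 / 8) (b δ)‖) {ns : ℕ → ℝ} (hns : Tendsto ns atTop (𝓝[>] 0)) {g : ℂ → ℂ} (hg : ContinuousOn g U) (hsmooth : ∀ φ : ℂ → ℂ, ContDiff ℝ ∞ φ → HasCompactSupport φ → tsupport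 φ ⊆ U → Tendsto (fun n => ((ns n : ℝ) : ℂ) ^ 2 * (∑ᶠ z ∈ hexDomainMidEdges (Λ (ns n)), φ (((ns n : ℝ) : ℂ) * hexMidpoint z) * hexParafermionicObservable (Λ (ns n)) (e (ns n)) hexCriticalFugacity (5 / 8) z) / hexParafermionicObservable (Λ (ns n)) (e (ns n)) hexCriticalFugacity (5 / 8) (b (ns n))) atTop (𝓝 (∫ z, φ z * g z))) {ψ : ℂ → ℂ} (hψ : Continuous ψ) (hψc : HasCompactSupport ψ) (hψU : tsupport ψ ⊆ U), Tendsto (fun n => ((ns n : ℝ) : ℂ) ^ 2 * (∑ᶠ z ∈ hexDomainMidEdges (Λ (ns n)), ψ (((ns n : ℝ) : ℂ) * hexMidpoint z) * hexParafermionicObservable (Λ (ns n)) (e (ns n)) hexCriticalFugacity (5 / 8) z) / hexParafermionicObservable (Λ (ns n)) (e (ns n)) hexCriticalFugacity (5 / 8) (b (ns n))) atTop (𝓝 (∫ z, ψ z * g z)) :=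
  @tendsto_functional_of_smooth

end Summit.CriticalPhenomena.SAWScalingLimit.Theorems.PickHalfPlane.DevelopingMap

end
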